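import Mathlib
import Summits.Ventures.PercRepro2.HCovCovariance
import Summits.Ventures.PercRepro2.GcInterior
import Summits.Ventures.PercRepro2.GcInteriorPos
import Summits.Ventures.PercRepro2.GcSkelReductionMinH

/-!
# (HCOV) as a covariance inequality, at interior weights: no side condition
(blind cell PercRepro2, typer-1 g55)

Typer-1 g15's `HCov_iff_covariance` (`HCovCovariance.lean`) reads (HCOV) over `ℝ` with Mathlib's
conditional measure and covariance — `HCov ↔ D · cov[1_{b∈U}, 1_{o∈U}; μ[|PD]] ≤ P(Q) · cov[σ_b, F; μ[|Q]]`
— under the side conditions `0 < P(Q)`, `0 < D`. At interior weights both hold for any three distinct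
marks (`PQ_pos_of_int`, `PD_pos_of_int`), so:

* **`HCov_iff_covariance_of_int`** — the covariance reading of (HCOV) at interior weights, no side
  condition;
* **`HCov_all_real_iff_covariance_int`** — the crux over `ℝ` IS the covariance inequality on the
  class of record at interior weights (`HCov_all_iff_HCovWRedMinH_int_all` at `R = ℝ`):
  conditioned on the roots being disconnected, the side sign of `b` and the signed functional
  `F = σ_o + σ₃ (γ − 1_{o∈U})` are positively correlated up to the `PD`-correction, on every
  graph of the class of record, at every interior weight.
-/

namespace Summit.Ventures.PercRepro2

open MeasureTheory ProbabilityTheory MeasureBridge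

namespace CovForm

section Interior

variable {V : Type*} {E : Type*} [Fintype E] [DecidableEq E]

/-- **(HCOV) in the language of conditional covariances, at interior weights** — no side
condition beyond three distinct marks. -/
theorem HCov_iff_covariance_of_int {p : E → ℝ} (hp : IsIntVec p) (ends : E → Sym2 V)
    (o a₁ a₂ a₃ b : V) (h12 : a₁ ≠ a₂) (h13 : a₁ ≠ a₃) (h23 : a₂ ≠ a₃) :
    HCov p ends o a₁ a₂ a₃ b ↔
      prob p (PDEvent ends a₁ a₂ a₃) *
          cov[inU ends a₁ a₂ b, inU ends a₁ a₂ o;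
            (percMeasureOf p hp.isProbVec)[|PDEvent ends a₁ a₂ a₃]] ≤
        prob p (avoidAll ends a₂ {a₁}) *
          cov[sigma ends a₁ a₂ b, Ffun ends o a₁ a₂ a₃ (gamma p ends o a₁ a₂ a₃);
            (percMeasureOf p hp.isProbVec)[|avoidAll ends a₂ {a₁}]] :=
  HCov_iff_covariance p hp.isProbVec ends o a₁ a₂ a₃ b (PQ_pos_of_int hp ends h12)
    (PD_pos_of_int hp ends h12 h13 h23)

end Interior

section Closure

/-- **THE CRUX OVER `ℝ` AS A COVARIANCE INEQUALITY ON THE CLASS OF RECORD AT INTERIOR WEIGHTS.** -/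
theorem HCov_all_real_iff_covariance_int :
    HCov_all ℝ ↔
      ∀ (V E : Type) [Fintype V] [DecidableEq V] [Fintype E] [DecidableEq E]
        (ends : E → Sym2 V) (p : E → ℝ) (hp : IsIntVec p),
        ∀ o a₁ a₂ a₃ b : V, a₁ ≠ a₂ → a₁ ≠ a₃ → a₂ ≠ a₃ → o ≠ a₁ → o ≠ a₂ → o ≠ a₃ → o ≠ b →
          b ≠ a₁ → b ≠ a₂ → b ≠ a₃ → WRed.WReducedMinH ends o a₁ a₂ a₃ b →
            prob p (PDEvent ends a₁ a₂ a₃) *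
                cov[inU ends a₁ a₂ b, inU ends a₁ a₂ o;
                  (percMeasureOf p hp.isProbVec)[|PDEvent ends a₁ a₂ a₃]] ≤
              prob p (avoidAll ends a₂ {a₁}) *
                cov[sigma ends a₁ a₂ b, Ffun ends o a₁ a₂ a₃ (gamma p ends o a₁ a₂ a₃);
                  (percMeasureOf p hp.isProbVec)[|avoidAll ends a₂ {a₁}]] := by
  rw [WRed.HCov_all_iff_HCovWRedMinH_int_all]
  constructor
  · intro h V E _ _ _ _ ends p hp o a₁ a₂ a₃ b h12 h13 h23 ho1 ho2 ho3 hob hb1 hb2 hb3 hred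
    exact (HCov_iff_covariance_of_int hp ends o a₁ a₂ a₃ b h12 h13 h23).1
      (h V E ends p hp o a₁ a₂ a₃ b h12 h13 h23 ho1 ho2 ho3 hob hb1 hb2 hb3 hred)
  · intro h V E _ _ _ _ ends p hp o a₁ a₂ a₃ b h12 h13 h23 ho1 ho2 ho3 hob hb1 hb2 hb3 hred
    exact (HCov_iff_covariance_of_int hp ends o a₁ a₂ a₃ b h12 h13 h23).2
      (h V E ends p hp o a₁ a₂ a₃ b h12 h13 h23 ho1 ho2 ho3 hob hb1 hb2 hb3 hred)

end Closure

end CovForm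

end Summit.Ventures.PercRepro2
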